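import Literature.MathematicalPhysics.QuantumFieldTheory.Balaban1983to89.T3AveragedTailProfile
import HarnessLib

/-!
# Crux `HistoryTailL` (stmt-QuantumFields-19936) — INTERIOR HEIGHTS SUFFICE: K2's body `HistoryTailAt` from per-height / per-plaquette
# bounds at the heights `j + 2 ≤ K` only (the two top heights `j ∈ {K−1, K}` are never needed)

Cell `ym3-torus` (YM ladder rung R3 = continuum SU(2) Yang–Mills on the three-torus — a RUNG, NOT the Clay problem: not d = 4, not
infinite volume, not a mass gap), width seat `ym-ust-19936-w3` gen 11, `--supports stmt-QuantumFields-19936 --as helper`.  THEOREMS ONLY,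
definition-free, ROUTE-INDEPENDENT (Literature imports only).  HONEST FRAMING: packaging bookkeeping over the tree's wedge reduction
✓`T3AveragedTailProfile.historyTailAt_of_averagedTailOnWedge`; nothing of `HistoryTailL`, `LocalInsertionL` (23607) or any crux/summit statement
is proved — the per-height / per-plaquette hypotheses are NOT in the tree.

WHY.  `HistoryTailAt F γ b₀ p₀ m` reads `histGood K ⌊K/m⌋`, i.e. the heights `j ≤ K − ⌊K/m⌋`; the wedge reduction already restricts every
per-height lever to `K ≤ m·(K − j + 1)`, which still contains the TOP heights `K − j ∈ {0, 1}` for the finitely many cut-offs `K ≤ 2m`.  There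
the bound `1` (a probability) is affordable: adding `4·2^{−i}` to the profile absorbs the depths `i ≤ 1`.  Hence every per-plaquette line on this
crux (in particular route LocalInsertion's `LocalInsertionL`, whose top heights are outside the K1 box — see
✓`InsertionStepOfConcentrationBoxFit`) may drop the two top heights from its supplier statement.
* ★★`historyTailAt_of_averagedTail_interior`: a summable profile `q ≥ 0` (with `Σ_n Σ'_t q(t+n) < ∞`) bounding the averaged-height events
  `Gibbs_K{¬PlaqSmall θ(K−j) (Ū^j)}` at the INTERIOR wedge heights `1 ≤ j`, `j + 2 ≤ K`, `K ≤ m(K−j+1)` gives `HistoryTailAt F γ b₀ p₀ m`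
  (profile `q + 4·2^{−i}`).
* ★★`historyTailAt_of_perPlaquette_interior`: the per-plaquette schema `Gibbs_K{θ(K−j) ≤ dist1(Ū^j(∂p))} ≤ C·β_{K−j}^A·e^{−c·p(g_{K−j})²}` at
  the interior wedge heights only gives `HistoryTailAt F γ b₀ p₀ m` (union bound over the `≤ 9·(2L^{m+K−j})³` plaquettes of the height +
  ✓`perHeight_bound`, then the first theorem).
* §3 (v1.1 append, same seat) ★★`historyTailAt_of_geometricTail_interior`: the geometric floor class `D·ρ^{K−j}` (`ρ·L³ < 1`) at the interior wedge
  heights only gives `HistoryTailAt F γ b₀ p₀ m` (interior twin of ✓`EntropyFloorHistoryTailOfGeometric.historyTailAt_of_geometricTail`).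
[cite: Balaban1985UV3, (7) p.257 and (71) p.273; King1986, (3.12) p.657]
-/

set_option autoImplicit false

noncomputable section

open scoped BigOperators
open MeasureTheory Filter Topology
open Literature.MathematicalPhysics.QuantumFieldTheory.Balaban1983to89
open Literature.MathematicalPhysics.QuantumFieldTheory.Balaban1983to89.T3ContinuumYM3Torus
open Literature.MathematicalPhysics.QuantumFieldTheory.Balaban1983to89.T3UnitScaleTilt
open Literature.MathematicalPhysics.QuantumFieldTheory.Balaban1983to89.T3UnitLawDensityEML
open Literature.MathematicalPhysics.QuantumFieldTheory.Balaban1983to89.T3CruxEstimates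
open Literature.MathematicalPhysics.QuantumFieldTheory.Balaban1983to89.T3AveragedTailProfile

namespace Summit.QuantumFields.YangMills.Theorems.LocalInsertion.InteriorHeights

/-! ## §1 Averaged-height profiles at the interior heights suffice -/

/-- The padding profile `4·2^{−i}` dominates `1` at the depths `i ≤ 1`. [folklore] -/
theorem one_le_four_mul_half_pow {i : ℕ} (hi : i ≤ 1) : (1 : ℝ) ≤ 4 * (1 / 2 : ℝ) ^ i := by
  interval_cases i <;> norm_num

/-- Shifted tail sums of the padding profile: `Σ'_t 4·2^{−(t+n)} = 8·2^{−n}`, a summable function of `n`. [folklore] -/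
theorem summable_tsum_shift_four_mul_half_pow :
    Summable fun n : ℕ => ∑' t : ℕ, (4 : ℝ) * (1 / 2 : ℝ) ^ (t + n) := by
  have heq : (fun n : ℕ => ∑' t : ℕ, (4 : ℝ) * (1 / 2 : ℝ) ^ (t + n)) = fun n => (8 : ℝ) * (1 / 2 : ℝ) ^ n := by
    funext n
    have h1 : (fun t : ℕ => (4 : ℝ) * (1 / 2 : ℝ) ^ (t + n)) = fun t => ((4 : ℝ) * (1 / 2 : ℝ) ^ n) * (1 / 2 : ℝ) ^ t := by
      funext t; rw [pow_add]; ring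
    rw [h1, tsum_mul_left, tsum_geometric_two]; ring
  rw [heq]
  exact (summable_geometric_of_lt_one (by norm_num) (by norm_num)).mul_left 8

/-- **INTERIOR HEIGHTS SUFFICE (profile form).**  `0 < γ ≤ 1`, `0 < b₀`, `1 ≤ p₀`, `m ≥ 1`: a profile `q ≥ 0`, `Σ q < ∞`, `Σ_n Σ'_t q(t+n) < ∞`
bounding `Gibbs_K{¬PlaqSmall θ(K−j) (Ū^{j})}` at the INTERIOR wedge heights `1 ≤ j`, `j + 2 ≤ K`, `K ≤ m·(K − j + 1)` gives
`HistoryTailAt F γ b₀ p₀ m` — ✓`historyTailAt_of_averagedTailOnWedge` applied to the padded profile `q(i) + 4·2^{−i}`, the top two heights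
(depths `K − j ≤ 1`) being charged the trivial bound `1 ≤ 4·2^{−(K−j)}`. [cite: Balaban1985UV3, (7) p.257 and (71) p.273] -/
theorem historyTailAt_of_averagedTail_interior (F : T3Family) {γ b₀ p₀ : ℝ} (hγ : 0 < γ) (hγ1 : γ ≤ 1) (hb₀ : 0 < b₀)
    (hp₀ : 1 ≤ p₀) {m : ℕ} (hm : 0 < m) (q : ℕ → ℝ) (hq0 : ∀ i, 0 ≤ q i) (hq : Summable q)
    (hqt : Summable fun n => ∑' t, q (t + n))
    (h : ∀ K j : ℕ, 1 ≤ j → j + 2 ≤ K → K ≤ m * (K - j + 1) →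
      (gibbsK F ℰp γ K).real
          {U | ¬ PlaqSmall (θBal F.L γ b₀ p₀ (K - j))
            (Averaging.iter (fun i => BlockAveraging.blockAvg (P := F.P K) (j := i) ℰp) j U)} ≤ q (K - j)) :
    HistoryTailAt F γ b₀ p₀ m := by
  have hg0 : ∀ i : ℕ, (0 : ℝ) ≤ 4 * (1 / 2 : ℝ) ^ i := fun i => by positivity
  have hgs : Summable fun i : ℕ => (4 : ℝ) * (1 / 2 : ℝ) ^ i :=
    (summable_geometric_of_lt_one (by norm_num) (by norm_num)).mul_left 4
  refine historyTailAt_of_averagedTailOnWedge F hγ hγ1 hb₀ hp₀ hm (fun i => q i + 4 * (1 / 2 : ℝ) ^ i)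
    (fun i => add_nonneg (hq0 i) (hg0 i)) (hq.add hgs) ?_ fun K j hj1 hjK hw => ?_
  · have heq : (fun n => ∑' t, (q (t + n) + 4 * (1 / 2 : ℝ) ^ (t + n))) =
        fun n => (∑' t, q (t + n)) + ∑' t, (4 : ℝ) * (1 / 2 : ℝ) ^ (t + n) := by
      funext n
      exact ((summable_nat_add_iff n).mpr hq).tsum_add ((summable_nat_add_iff n).mpr hgs)
    rw [heq]
    exact hqt.add summable_tsum_shift_four_mul_half_pow
  · haveI := isProbabilityMeasure_gibbsK F ℰp hγ.le K
    by_cases hint : j + 2 ≤ K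
    · exact (h K j hj1 hint hw).trans (le_add_of_nonneg_right (hg0 _))
    · have htop : K - j ≤ 1 := by omega
      calc (gibbsK F ℰp γ K).real {U | ¬ PlaqSmall (θBal F.L γ b₀ p₀ (K - j))
              (Averaging.iter (fun i => BlockAveraging.blockAvg (P := F.P K) (j := i) ℰp) j U)}
          ≤ 1 := measureReal_le_one
        _ ≤ 4 * (1 / 2 : ℝ) ^ (K - j) := one_le_four_mul_half_pow htop
        _ ≤ q (K - j) + 4 * (1 / 2 : ℝ) ^ (K - j) := le_add_of_nonneg_left (hq0 _)

/-! ## §2 The per-plaquette schema at the interior heights suffices -/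

/-- **INTERIOR HEIGHTS SUFFICE (per-plaquette form).**  `0 < γ ≤ 1`, `0 < b₀`, `1 ≤ p₀`, `m ≥ 1`: if for some `C ≥ 0`, `A : ℕ`, `c > 0` every
block-averaged plaquette `p` of an INTERIOR wedge height (`1 ≤ j`, `j + 2 ≤ K`, `K ≤ m·(K − j + 1)`) of every approximation `K` has Gibbs tail
`Gibbs_K{θ(K−j) ≤ dist1(Ū^{j}(∂p))} ≤ C·β_{K−j}^A·e^{−c·p(g_{K−j})²}`, then `HistoryTailAt F γ b₀ p₀ m` — the interior twin of
✓`historyTailAt_of_perPlaquetteOnWedge` (union bound over the plaquettes of the height, ✓`perHeight_bound`, profile `A'·2^{−i}`, then §1).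
[cite: Balaban1985UV3, (7) p.257 and (71) p.273; King1986, (3.12) p.657] -/
theorem historyTailAt_of_perPlaquette_interior (F : T3Family) {γ b₀ p₀ : ℝ} (hγ : 0 < γ) (hγ1 : γ ≤ 1) (hb₀ : 0 < b₀)
    (hp₀ : 1 ≤ p₀) {m : ℕ} (hm : 0 < m)
    (h : ∃ (C : ℝ) (A : ℕ) (c : ℝ), 0 ≤ C ∧ 0 < c ∧
      ∀ (K j : ℕ), 1 ≤ j → j + 2 ≤ K → K ≤ m * (K - j + 1) → ∀ p : Plaq (F.P K) j,
        (gibbsK F ℰp γ K).real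
            {U | θBal F.L γ b₀ p₀ (K - j) ≤
              GaugeGroup.dist1 (GaugeField.plaqHol
                (Averaging.iter (fun i => BlockAveraging.blockAvg (P := F.P K) (j := i) ℰp) j U) p)} ≤
          C * (F.scheme ℰp γ).β (K - j) ^ A *
            Real.exp (-(c * B10.pFun b₀ p₀ (Real.sqrt (γ * ((F.L : ℝ)⁻¹) ^ (K - j))) ^ 2))) :
    HistoryTailAt F γ b₀ p₀ m := by
  obtain ⟨C, A, c, hC, hc, hbound⟩ := h
  -- the explicit constant of `perHeight_bound`
  obtain ⟨A', hA'def⟩ : ∃ A' : ℝ, A' = 72 * C * (F.L : ℝ) ^ (3 * F.m) * γ⁻¹ ^ A *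
      Real.exp ((((3 : ℝ) + A) * Real.log F.L + Real.log 2) ^ 2 / (4 * (c * b₀ ^ 2 * Real.log F.L ^ 2 / 4))) := ⟨_, rfl⟩
  have hA'0 : 0 ≤ A' := by rw [hA'def]; positivity
  refine historyTailAt_of_averagedTail_interior F hγ hγ1 hb₀ hp₀ hm (fun i => A' * (1 / 2 : ℝ) ^ i) (fun i => by positivity)
    ((summable_geometric_of_lt_one (by norm_num) (by norm_num)).mul_left A') ?_ fun K j hj1 hjK hw => ?_
  · have heq : (fun n => ∑' t, A' * (1 / 2 : ℝ) ^ (t + n)) = fun n => (2 * A') * (1 / 2 : ℝ) ^ n := by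
      funext n
      have h1 : (fun t => A' * (1 / 2 : ℝ) ^ (t + n)) = fun t => (A' * (1 / 2 : ℝ) ^ n) * (1 / 2 : ℝ) ^ t := by
        funext t; rw [pow_add]; ring
      rw [h1, tsum_mul_left, tsum_geometric_two]; ring
    rw [heq]
    exact (summable_geometric_of_lt_one (by norm_num) (by norm_num)).mul_left (2 * A')
  · -- the union bound over the plaquettes of height `j`, pulled back along the `j`-fold averaging
    haveI := isProbabilityMeasure_gibbsK F ℰp hγ.le K
    have hunion := real_not_plaqSmall_comp_le_sum (gibbsK F ℰp γ K)
      (fun U => Averaging.iter (fun i => BlockAveraging.blockAvg (P := F.P K) (j := i) ℰp) j U) (θBal F.L γ b₀ p₀ (K - j))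
    refine hunion.trans ?_
    refine (Finset.sum_le_sum fun p _ => hbound K j hj1 hjK hw p).trans ?_
    rw [Finset.sum_const, Finset.card_univ, nsmul_eq_mul]
    have hnonneg : 0 ≤ C * (F.scheme ℰp γ).β (K - j) ^ A *
        Real.exp (-(c * B10.pFun b₀ p₀ (Real.sqrt (γ * ((F.L : ℝ)⁻¹) ^ (K - j))) ^ 2)) :=
      mul_nonneg (mul_nonneg hC (pow_nonneg (F.scheme_β_nonneg ℰp hγ.le (K - j)) A)) (Real.exp_nonneg _)
    -- `#plaquettes of T^{(j)}_K ≤ 9·(8·L^{3m}·(L^{K−j})³)` (the tree's count, inlined: `d² = 9` plane labels, `2L^{m+K−j}` sites per direction)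
    have hcard : (Fintype.card (Plaq (F.P K) j) : ℝ) ≤ 9 * (8 * (F.L : ℝ) ^ (3 * F.m) * ((F.L : ℝ) ^ (K - j)) ^ 3) := by
      have hN : (F.P K).sitesPerDir j = 2 * F.L ^ (F.m + (K - j)) := by
        show 2 * F.L ^ (F.m + K - j) = 2 * F.L ^ (F.m + (K - j))
        rw [show F.m + K - j = F.m + (K - j) by omega]
      have h1 : Fintype.card (Plaq (F.P K) j) =
          Fintype.card (Literature.MathematicalPhysics.QuantumFieldTheory.Plaquette 3 ((F.P K).sitesPerDir j)) :=
        Fintype.card_congr (plaqEquiv (P := F.P K) j)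
      have h2 : Fintype.card (Literature.MathematicalPhysics.QuantumFieldTheory.Plaquette 3 ((F.P K).sitesPerDir j)) ≤
          ((F.P K).sitesPerDir j) ^ 3 * 3 ^ 2 := by
        rw [Fintype.card_prod, Fintype.card_fun, ZMod.card, Fintype.card_fin]
        gcongr
        calc Fintype.card {p : Fin 3 × Fin 3 // p.1 < p.2} ≤ Fintype.card (Fin 3 × Fin 3) := Fintype.card_subtype_le _
          _ = 3 ^ 2 := by rw [Fintype.card_prod, Fintype.card_fin]; norm_num
      rw [h1]
      calc (Fintype.card (Literature.MathematicalPhysics.QuantumFieldTheory.Plaquette 3 ((F.P K).sitesPerDir j)) : ℝ)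
          ≤ (((F.P K).sitesPerDir j) ^ 3 * 3 ^ 2 : ℕ) := by exact_mod_cast h2
        _ = 9 * (8 * (F.L : ℝ) ^ (3 * F.m) * ((F.L : ℝ) ^ (K - j)) ^ 3) := by rw [hN]; push_cast; ring
    refine (mul_le_mul_of_nonneg_right hcard hnonneg).trans ?_
    rw [hA'def]
    exact perHeight_bound F hγ hγ1 hb₀ hp₀ hC A hc (K - j)


/-! ## §3 (v1.1, same seat) The geometric floor class at the interior heights -/

/-- Shifted tail sums of a geometric profile: `Σ'_t A·r^{t+n} = A·r^n·(1−r)⁻¹`, summable in `n` (`0 ≤ r < 1`). [folklore] -/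
theorem summable_tsum_shift_geometric (A : ℝ) {r : ℝ} (hr0 : 0 ≤ r) (hr1 : r < 1) :
    Summable fun n : ℕ => ∑' t : ℕ, A * r ^ (t + n) := by
  have heq : (fun n : ℕ => ∑' t : ℕ, A * r ^ (t + n)) = fun n => (A * (1 - r)⁻¹) * r ^ n := by
    funext n
    have h1 : (fun t : ℕ => A * r ^ (t + n)) = fun t => (A * r ^ n) * r ^ t := by
      funext t; rw [pow_add]; ring
    rw [h1, tsum_mul_left, tsum_geometric_of_lt_one hr0 hr1]; ring
  rw [heq]
  exact (summable_geometric_of_lt_one hr0 hr1).mul_left _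

/-- **INTERIOR HEIGHTS SUFFICE (geometric floor form).**  `0 < γ ≤ 1`, `0 < b₀`, `1 ≤ p₀`, `m ≥ 1`: if for some `D ≥ 0` and `0 ≤ ρ` with
`ρ·L³ < 1` every block-averaged plaquette `p` of an INTERIOR wedge height (`1 ≤ j`, `j + 2 ≤ K`, `K ≤ m·(K − j + 1)`) of every approximation `K`
has Gibbs tail `Gibbs_K{θ(K−j) ≤ dist1(Ū^{j}(∂p))} ≤ D·ρ^{K−j}`, then `HistoryTailAt F γ b₀ p₀ m` — the interior twin of
✓`EntropyFloorHistoryTailOfGeometric.historyTailAt_of_geometricTail` (union bound, profile `72·D·L^{3m}·(ρL³)^i`, then §1). [cite: Balaban1985UV3, (71) p.273] -/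
theorem historyTailAt_of_geometricTail_interior (F : T3Family) {γ b₀ p₀ : ℝ} (hγ : 0 < γ) (hγ1 : γ ≤ 1) (hb₀ : 0 < b₀)
    (hp₀ : 1 ≤ p₀) {m : ℕ} (hm : 0 < m)
    (h : ∃ (D ρ : ℝ), 0 ≤ D ∧ 0 ≤ ρ ∧ ρ * (F.L : ℝ) ^ 3 < 1 ∧
      ∀ (K j : ℕ), 1 ≤ j → j + 2 ≤ K → K ≤ m * (K - j + 1) → ∀ p : Plaq (F.P K) j,
        (gibbsK F ℰp γ K).real
            {U | θBal F.L γ b₀ p₀ (K - j) ≤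
              GaugeGroup.dist1 (GaugeField.plaqHol
                (Averaging.iter (fun i => BlockAveraging.blockAvg (P := F.P K) (j := i) ℰp) j U) p)} ≤
          D * ρ ^ (K - j)) :
    HistoryTailAt F γ b₀ p₀ m := by
  obtain ⟨D, ρ, hD, hρ, hρL, hbound⟩ := h
  have hL0 : (0 : ℝ) ≤ F.L := Nat.cast_nonneg _
  set r : ℝ := ρ * (F.L : ℝ) ^ 3 with hr
  have hr0 : 0 ≤ r := mul_nonneg hρ (pow_nonneg hL0 3)
  set A' : ℝ := 72 * D * (F.L : ℝ) ^ (3 * F.m) with hA'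
  have hA'0 : 0 ≤ A' := by positivity
  refine historyTailAt_of_averagedTail_interior F hγ hγ1 hb₀ hp₀ hm (fun i => A' * r ^ i)
    (fun i => mul_nonneg hA'0 (pow_nonneg hr0 i)) ((summable_geometric_of_lt_one hr0 hρL).mul_left A')
    (summable_tsum_shift_geometric A' hr0 hρL) fun K j hj1 hjK hw => ?_
  -- the union bound over the plaquettes of height `j`, pulled back along the `j`-fold averaging
  haveI := isProbabilityMeasure_gibbsK F ℰp hγ.le K
  have hunion := real_not_plaqSmall_comp_le_sum (gibbsK F ℰp γ K)
    (fun U => Averaging.iter (fun i => BlockAveraging.blockAvg (P := F.P K) (j := i) ℰp) j U) (θBal F.L γ b₀ p₀ (K - j))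
  refine hunion.trans ?_
  refine (Finset.sum_le_sum fun p _ => hbound K j hj1 hjK hw p).trans ?_
  rw [Finset.sum_const, Finset.card_univ, nsmul_eq_mul]
  have hnonneg : 0 ≤ D * ρ ^ (K - j) := mul_nonneg hD (pow_nonneg hρ _)
  -- `#plaquettes of T^{(j)}_K ≤ 72·L^{3m}·(L³)^{K−j}` (the tree's count, inlined)
  have hcard : (Fintype.card (Plaq (F.P K) j) : ℝ) ≤ 72 * (F.L : ℝ) ^ (3 * F.m) * ((F.L : ℝ) ^ 3) ^ (K - j) := by
    have hN : (F.P K).sitesPerDir j = 2 * F.L ^ (F.m + (K - j)) := by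
      show 2 * F.L ^ (F.m + K - j) = 2 * F.L ^ (F.m + (K - j))
      rw [show F.m + K - j = F.m + (K - j) by omega]
    have h1 : Fintype.card (Plaq (F.P K) j) =
        Fintype.card (Literature.MathematicalPhysics.QuantumFieldTheory.Plaquette 3 ((F.P K).sitesPerDir j)) :=
      Fintype.card_congr (plaqEquiv (P := F.P K) j)
    have h2 : Fintype.card (Literature.MathematicalPhysics.QuantumFieldTheory.Plaquette 3 ((F.P K).sitesPerDir j)) ≤
        ((F.P K).sitesPerDir j) ^ 3 * 3 ^ 2 := by
      rw [Fintype.card_prod, Fintype.card_fun, ZMod.card, Fintype.card_fin]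
      gcongr
      calc Fintype.card {p : Fin 3 × Fin 3 // p.1 < p.2} ≤ Fintype.card (Fin 3 × Fin 3) := Fintype.card_subtype_le _
        _ = 3 ^ 2 := by rw [Fintype.card_prod, Fintype.card_fin]; norm_num
    rw [h1]
    calc (Fintype.card (Literature.MathematicalPhysics.QuantumFieldTheory.Plaquette 3 ((F.P K).sitesPerDir j)) : ℝ)
        ≤ (((F.P K).sitesPerDir j) ^ 3 * 3 ^ 2 : ℕ) := by exact_mod_cast h2
      _ = 72 * (F.L : ℝ) ^ (3 * F.m) * ((F.L : ℝ) ^ 3) ^ (K - j) := by rw [hN]; push_cast; ring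
  calc (Fintype.card (Plaq (F.P K) j) : ℝ) * (D * ρ ^ (K - j))
      ≤ (72 * (F.L : ℝ) ^ (3 * F.m) * ((F.L : ℝ) ^ 3) ^ (K - j)) * (D * ρ ^ (K - j)) :=
        mul_le_mul_of_nonneg_right hcard hnonneg
    _ = A' * r ^ (K - j) := by rw [hA', hr, mul_pow]; ring

end Summit.QuantumFields.YangMills.Theorems.LocalInsertion.InteriorHeights
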